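import Summits.BirchSwinnertonDyer.BirchSwinnertonDyer.Theorems.PrintCFramBottomClassIndexLawFiveLeBorelNoPTorsionInputs
import Summits.BirchSwinnertonDyer.BirchSwinnertonDyer.Theorems.PrintCFramBottomClassIndexLawFiveLeGenusCrossingHeegnerField
import Literature.NumberTheory.EllipticCurves.HeegnerPointsRationalityProofs
import Literature.NumberTheory.EllipticCurves.HeegnerPointsClassesProofs
import Literature.NumberTheory.EllipticCurves.HeegnerPointsProofs
import Literature.NumberTheory.EllipticCurves.ModularParametrizationDegreeHoldsProofs
import Literature.NumberTheory.EllipticCurves.ModularParametrizationTrustBaseProofs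
import Literature.NumberTheory.EllipticCurves.RootNumberEvenAnalyticRankProofs
import Summits.BirchSwinnertonDyer.BirchSwinnertonDyer.Theses.PrintCFram
import Summits.BirchSwinnertonDyer.BirchSwinnertonDyer.Theorems.RamifiedSevenEllipticUnitsRubinFormulaZpBsdp
import Summits.BirchSwinnertonDyer.BirchSwinnertonDyer.Theorems.AdditiveRankOneBSDpOfExactIndexManin
import Summits.BirchSwinnertonDyer.Rank1Residual.X11b.BDPRouteOnTreeStepL
import Summits.BirchSwinnertonDyer.Rank1Residual.Partition.CornersCM
import HarnessLib

/-!
# Route `PrintCFram`, crux `BottomClassIndexLawFiveLe` (item stmt-BirchSwinnertonDyer-20372): the HEEGNER FRAME SUPPLY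
# for the two published Kolyvagin-type lines on the B1 residue — stub S1 `stub_heegnerFrame_cmRamified`
# (`Lines/borel_heegner_squeeze.lean`) ≡ `stub_heegnerFrame_bip` (`Lines/bipartite_toric_borel.lean`), PROVED VERBATIM

Width seat `bsd-line-cfram-p1-w8` g13 (cell `bsd-print-cfram`); helper `--supports stmt-BirchSwinnertonDyer-20372`; THEOREMS
ONLY (no definition, no named fact, no `sorry`). BSD is not proved by any of this; no summit statement is proved here; no
REGISTERED stub of the line of record (`eisenstein_resource_bdp_line` v31) is closed by this file.

## What

After registry v31 («END STATE», LEAD g14) the only open residue of the line of record is the arithmetic B1 pair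
(`stub_bsdp_of_level`, `stub_bsdp_of_sha_levelZero` = `BSD_p` for the irregular rank-one CM-ramified members). The crux
directory holds two published (publish-only, un-registered) Kolyvagin-type lines that attack exactly that residue through
`SchneiderFree.Exact.bsdp_of_exactIndexManin_of_partner_bsdp`: `borel_heegner_squeeze` (idea-7 g4) and
`bipartite_toric_borel` (idea-7 g16, critic-10 V#136 PASS-WITH-PRICE). Both start from the SAME assembly stub S1 («size M ·
true: every piece is a tree theorem or a named fact · one target, proved once»): for every class member — `W/ℚ` globally
minimal with CM, `p ≥ 5` CM-ramified, `r_an(W) = 1` — granted the Modularity Theorem as newform existence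
(`exists_isNewformOf`) and Hoffstein–Luo 1997 (`HoffsteinLuo1997_exists_twist_L_one_ne_zero`), there is a full
anticyclotomic HEEGNER FRAME: the level `N = N_W` with `p ∣ N`, an imaginary quadratic `K` with ODD discriminant satisfying
the Heegner hypothesis for `N`, `p ∤ #𝓞_K^×`, `L(W^{(d_K)}, 1) ≠ 0`, a modular parametrisation datum `Dt` of level `N`, a
Heegner datum `H`, an embedding `ι : K → ℂ`, THE Heegner point `P ∈ W(K)` (`ι P = heegnerPointComplex Dt H`), and a
globally minimal model `Wd` of the twist `W^{(d_K)}`, again CM.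

* §1 `exists_oddHeegnerField_twist_ne_zero` (CM-free): for ANY elliptic `W/ℚ` with `w(W) = −1`, a finite set `S` of
  primes and a bound `B`, an imaginary quadratic `K` with `|d_K| > B`, `d_K ≡ 1 (mod 8)`, Heegner for `N_W` and for every
  prime of `S`, and `L(W^{(d_K)}, 1) ≠ 0` — Hoffstein–Luo's «moreover» clause (`exists_neg_fundamental_twist_ne_zero_of_hoffsteinLuo`:
  the sign `d < 0` is forced by `w(W) = −1`, Murty–Murty Ch. 6 §1) pushed through the tree's dictionary
  `exists_heegnerField_iff_exists_fundamental` at level `N_W · ∏ S`.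
* §2 `exists_heegnerFrame_of_rootNumber_eq_neg_one` (CM-free): the full frame for ANY globally minimal `W` with
  `w(W) = −1`, with `|d_K| > B`, `d_K ≡ 1 (mod 8)`, `#𝓞_K^× = 2`, prescribed extra split set `S`, `j(Wd) = j(W)` and
  `r_an(Wd) = 0`; the sockets are `nonempty_modularParametrizationData_of_exists_isNewformOf` with the tree theorem
  `IsNewformOf.exists_maninConstant_ne_zero_holds`, `exists_dvd_sq_sub_discr_holds` + `nonempty_heegnerDatum_holds` (Gross 1984
  §3), `heegnerPointComplex_mem_range_map_holds` (Darmon 2004 Thms. 3.6–3.7: `K`-rationality of the trace), Silverman VIII.8.3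
  (`hasGlobalMinimalModel_rat_holds`), `torsionOrder_eq_two_of_discr_lt_neg_four` (`d_K < −4`).
* §3 `heegnerFrame_cmRamified` = S1 VERBATIM (both lines' `stub_heegnerFrame_*` close by `exact heegnerFrame_cmRamified`):
  `r_an(W) = 1 ⟹ w(W) = −1` (`rootNumber_eq_neg_one_pow_analyticRank_of_exists_isNewformOf`), `p ∣ N_W`
  (`BorelTorsion.dvd_conductorNorm_of_cmRamified`: a CM-ramified prime is additive), `p ∤ #𝓞_K^×` for the odd `p ∣ N`
  split in `K` (`X11b.Three.not_dvd_discr_and_not_dvd_torsionOrder_of_heegner`), `Wd` CM (`KatzGenusCrossing.twistModel_facts`).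
  §3 also records the frame with the two extras the Kolyvagin lines use next (`heegnerFrame_cmRamified_extras`: `|d_K| > B`,
  an extra split set `S`, `p ∤ d_K`, `#𝓞_K^× = 2`, `j(Wd) = j(W)`, `Wd` CM-ramified at `p`, `r_an(Wd) = 0`).

CONDITIONAL only on the two refereed named facts that S1 itself takes as antecedents (`exists_isNewformOf`: BCDT 2001 Thm. A;
`HoffsteinLuo1997_exists_twist_L_one_ne_zero`: Hoffstein–Luo 1997, Theorem) — both appear as HYPOTHESES of the theorems, exactly as
in the stub. beyond-print theorem: NO (assembly of printed theorems). Supports, does not close, stmt-BirchSwinnertonDyer-20372.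

References: [HoffsteinLuo1997] J. Hoffstein, W. Luo, Math. Res. Lett. 4 (1997) 435–444, Theorem (§1, pp. 435–436);
[MurtyMurty1997] Ch. 6 §1 (p. 96); [BCDTJAMS2001] Thm. A; [Gross1984] §3; [GrossZagier1986] I.§3–§4, I.(6.3);
[Darmon2004] Thm. 3.6, Thm. 3.7, §3.7 and Hyp. 3.9; [SilvermanAEC2009] VIII.8 Cor. 8.3, X.5 Prop. 5.4, App. C §16;
[GrossLMS1991] §1 (p. 235); [Oesterle1988Gauss] II §1 (p. 53).
-/

noncomputable section

open scoped Classical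

open NumberField WeierstrassCurve
open Literature.NumberTheory.EllipticCurves Literature.NumberTheory.EllipticCurves.ModularForms
open Literature.NumberTheory.EllipticCurves.Rank1Residual
open Summit.BirchSwinnertonDyer.Rank1Residual Summit.BirchSwinnertonDyer.Rank1Residual.X12.O11
open Summit.BirchSwinnertonDyer.BirchSwinnertonDyer.Theorems.SchneiderFree
open Summit.BirchSwinnertonDyer.BirchSwinnertonDyer.Theorems.RamifiedSevenEllipticUnits

set_option linter.dupNamespace false
set_option autoImplicit false

namespace Summit.BirchSwinnertonDyer.BirchSwinnertonDyer.Theorems.PrintCFram.HeegnerFrameSupply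

/-! ## §1 An imaginary quadratic field with ODD discriminant, prescribed splitting and a non-vanishing twist (CM-free) -/

/-- **Friedberg–Hoffstein / Hoffstein–Luo supply with ODD discriminant and prescribed splitting.** For every elliptic
`W/ℚ` of root number `−1`, every finite set `S` and every bound `B` there is an imaginary quadratic field `K` with
`|d_K| > B`, `d_K ≡ 1 (mod 8)` (so `d_K` is odd and `2` splits), in which every prime of the conductor `N_W` splits
(Heegner hypothesis for `N_W`) and every prime of `S` splits, and with `L(W^{(d_K)}, 1) ≠ 0`. Proof: Hoffstein–Luo's
theorem with `S ∪ {ℓ ∣ N_W}` gives a square-free `d ≡ 1 (mod 8)` with `(d/ℓ) = 1` at those odd primes and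
`L(W^{(d)}, 1) ≠ 0`; `w(W) = −1` forces `d < 0` (`exists_neg_fundamental_twist_ne_zero_of_hoffsteinLuo`); `K = ℚ(√d)` has
`d_K = d` and the splitting is the Kronecker condition (`exists_heegnerField_iff_exists_fundamental` at level
`N_W · ∏_{q ∈ S prime} q`). CONDITIONAL on the two named facts. [cite: HoffsteinLuo1997, Theorem (§1, pp. 435–436)]
[cite: MurtyMurty1997, Ch. 6 §1, p. 96] [cite: Darmon2004, §3.9, proof of Thm. 3.22] -/
theorem exists_oddHeegnerField_twist_ne_zero (hnf : exists_isNewformOf)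
    (hHL : HoffsteinLuo1997_exists_twist_L_one_ne_zero)
    (W : WeierstrassCurve ℚ) [W.IsElliptic] (hw : W.rootNumber = -1) (S : Finset ℕ) (B : ℕ) :
    ∃ (K : Type) (_ : Field K) (_ : NumberField K),
      IsImaginaryQuadratic K ∧ B < (NumberField.discr K).natAbs ∧ NumberField.discr K % 8 = 1 ∧
      SatisfiesHeegnerHypothesis (W.conductorNorm ℤ) K ∧
      (∀ q ∈ S, q.Prime → SatisfiesHeegnerHypothesis q K) ∧
      (W.quadraticTwist (NumberField.discr K : ℚ)).entireLFunction 1 ≠ 0 := by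
  obtain ⟨d, hdneg, hsq, hd8, hBd, hjacS, hjacN, hL⟩ :=
    exists_neg_fundamental_twist_ne_zero_of_hoffsteinLuo hnf hHL W hw S B
  -- the auxiliary level `N_W · M`, `M` the product of the primes of `S`
  set M : ℕ := (S.filter Nat.Prime).prod id with hM
  have hkr : ∀ q : ℕ, q.Prime → q ∣ W.conductorNorm ℤ * M →
      (q = 2 → d % 8 = 1) ∧ (q ≠ 2 → jacobiSym d q = 1) := by
    intro q hq hqNM
    refine ⟨fun _ ↦ hd8, fun hq2 ↦ ?_⟩
    rcases (Nat.Prime.dvd_mul hq).mp hqNM with hqN | hqM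
    · exact hjacN q hq hqN hq2
    · obtain ⟨r, hr, hqr⟩ := (Prime.dvd_finsetProd_iff hq.prime id).mp hqM
      obtain ⟨hrS, hrp⟩ := Finset.mem_filter.mp hr
      have hqr' : q = r := (Nat.prime_dvd_prime_iff_eq hq hrp).mp hqr
      subst hqr'
      exact hjacS q hrS hq hq2
  obtain ⟨K, iF, iN, hK, hB, hH, hd8K, hLK⟩ :=
    (exists_heegnerField_iff_exists_fundamental (W.conductorNorm ℤ * M) B
      (fun D ↦ D % 8 = 1 ∧ (W.quadraticTwist (D : ℚ)).entireLFunction 1 ≠ 0)).mpr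
      ⟨d, hdneg, Or.inl ⟨by omega, hsq, by omega⟩, hBd, hkr, hd8, hL⟩
  refine ⟨K, iF, iN, hK, hB, hd8K, ?_, ?_, hLK⟩
  · exact hH.of_dvd (dvd_mul_right _ _)
  · intro q hqS hq
    exact hH.of_dvd ((Finset.dvd_prod_of_mem id (Finset.mem_filter.mpr ⟨hqS, hq⟩)).trans (dvd_mul_left _ _))

/-! ## §2 The full Heegner frame of a curve of root number `−1` (CM-free) -/

/-- **The anticyclotomic Heegner frame of a globally minimal `W/ℚ` with `w(W) = −1` (CM-free; prescribed extra split set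
`S`, bound `B`).** Granted `exists_isNewformOf` and Hoffstein–Luo 1997: the level `N = N_W`; an imaginary quadratic `K` with
`|d_K| > B`, `d_K ≡ 1 (mod 8)`, `d_K < −4`, `#𝓞_K^× = 2`, Heegner for `N` and for every prime of `S`, `L(W^{(d_K)}, 1) ≠ 0`;
a modular parametrisation datum `Dt` of level `N` (`nonempty_modularParametrizationData_of_exists_isNewformOf`, the rational
Manin constant being the tree theorem `IsNewformOf.exists_maninConstant_ne_zero_holds`); a Heegner datum `H` (a `β` with
`β² ≡ d_K (mod 4N)` exists under the Heegner hypothesis, `exists_dvd_sq_sub_discr_holds`, Gross 1984 §3); an embedding `ι`;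
THE Heegner point `P ∈ W(K)` (`heegnerPointComplex_mem_range_map_holds`, Darmon 2004 Thms. 3.6–3.7); a globally minimal
model `Wd` of `W^{(d_K)}` (Silverman VIII.8.3) with `j(Wd) = j(W)` and `r_an(Wd) = 0`. CONDITIONAL on the two facts.
[cite: HoffsteinLuo1997, Theorem (§1, pp. 435–436)] [cite: BCDTJAMS2001, Thm. A] [cite: Gross1984, §3]
[cite: Darmon2004, Thm. 3.6 and Thm. 3.7 (PDF pp. 43–44)] [cite: SilvermanAEC2009, VIII.8 Cor. 8.3 and X.5 Prop. 5.4]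
[cite: Oesterle1988Gauss, II §1 p. 53] -/
theorem exists_heegnerFrame_of_rootNumber_eq_neg_one (hnf : exists_isNewformOf)
    (hHL : HoffsteinLuo1997_exists_twist_L_one_ne_zero)
    (W : WeierstrassCurve ℚ) [W.IsElliptic] [W.IsGloballyMinimal] (hw : W.rootNumber = -1)
    (S : Finset ℕ) (B : ℕ) :
    ∃ (N : ℕ) (_ : NeZero N) (K : Type) (_ : Field K) (_ : NumberField K)
      (Dt : ModularParametrizationData W N) (H : HeegnerDatum N (NumberField.discr K)) (ι : K →+* ℂ)
      (P : (W.baseChange K).toAffine.Point) (Wd : WeierstrassCurve ℚ) (_ : Wd.IsElliptic)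
      (_ : Wd.IsGloballyMinimal),
      W.conductorNorm ℤ = N ∧ IsImaginaryQuadratic K ∧ B < (NumberField.discr K).natAbs ∧
      NumberField.discr K % 8 = 1 ∧ NumberField.discr K < -4 ∧ Units.torsionOrder K = 2 ∧
      SatisfiesHeegnerHypothesis N K ∧ (∀ q ∈ S, q.Prime → SatisfiesHeegnerHypothesis q K) ∧
      (W.quadraticTwist (NumberField.discr K : ℚ)).entireLFunction 1 ≠ 0 ∧
      WeierstrassCurve.Affine.Point.map ι.toRatAlgHom P = heegnerPointComplex Dt H ∧
      (∃ C : VariableChange ℚ, C • W.quadraticTwist (NumberField.discr K : ℚ) = Wd) ∧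
      Wd.j = W.j ∧ Wd.analyticRank = 0 := by
  haveI hN0 : NeZero (W.conductorNorm ℤ) := ⟨(W.conductorNorm_pos_holds).ne'⟩
  -- the field, with bound `max B 4` so that `d_K < -4`
  obtain ⟨K, iF, iN, hK, hB, hd8, hHN, hHS, hL⟩ :=
    exists_oddHeegnerField_twist_ne_zero hnf hHL W hw S (max B 4)
  have hneg : NumberField.discr K < 0 := hK.discr_neg
  have hlt4 : NumberField.discr K < -4 := by
    have habs : ((NumberField.discr K).natAbs : ℤ) = -NumberField.discr K :=
      Int.ofNat_natAbs_of_nonpos hneg.le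
    have h4 : (4 : ℤ) < ((NumberField.discr K).natAbs : ℤ) := by
      have := (le_max_right B 4).trans_lt hB
      exact_mod_cast this
    omega
  have hμ : Units.torsionOrder K = 2 :=
    Literature.NumberTheory.QuadraticFields.Quadratic.torsionOrder_eq_two_of_discr_lt_neg_four hK.1 hlt4
  -- parametrisation, Heegner datum, embedding, the Heegner point over `K`
  obtain ⟨Dt⟩ := nonempty_modularParametrizationData_of_exists_isNewformOf hnf
    IsNewformOf.exists_maninConstant_ne_zero_holds W
  obtain ⟨H, -⟩ := nonempty_heegnerDatum_holds (W.conductorNorm ℤ) K hK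
    (exists_dvd_sq_sub_discr_holds (W.conductorNorm ℤ) K hK hHN).choose_spec
  obtain ⟨ι⟩ : Nonempty (K →+* ℂ) := inferInstance
  obtain ⟨P, hP⟩ := heegnerPointComplex_mem_range_map_holds (W.conductorNorm ℤ) W K hK hHN Dt H ι
  -- the globally minimal twist model
  have hd0 : (NumberField.discr K : ℚ) ≠ 0 := by exact_mod_cast NumberField.discr_ne_zero K
  haveI : (W.quadraticTwist (NumberField.discr K : ℚ)).IsElliptic := W.isElliptic_quadraticTwist hd0
  obtain ⟨Wd, hEd, hMd, Cd, hCd⟩ := exists_isGloballyMinimal_smul_eq_quadraticTwist W hd0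
  have hjd : Wd.j = W.j := by
    have key : ∀ (V : WeierstrassCurve ℚ) [V.IsElliptic], V = W.quadraticTwist (NumberField.discr K : ℚ) →
        V.j = W.j := by
      rintro V _ rfl
      exact j_quadraticTwist W hd0
    rw [← WeierstrassCurve.variableChange_j Wd Cd]
    exact key _ hCd
  have hrd : Wd.analyticRank = 0 := by
    rw [← analyticRank_smul Wd Cd, hCd]
    exact Rank1Residual.analyticRank_eq_zero_of_entireLFunction_one_ne_zero hL
  have hC : ∃ C : VariableChange ℚ, C • W.quadraticTwist (NumberField.discr K : ℚ) = Wd :=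
    ⟨Cd⁻¹, by rw [← hCd, inv_smul_smul]⟩
  have hBK : B < (NumberField.discr K).natAbs := (le_max_left B 4).trans_lt hB
  exact ⟨W.conductorNorm ℤ, hN0, K, iF, iN, Dt, H, ι, P, Wd, hEd, hMd, rfl, hK, hBK, hd8, hlt4, hμ, hHN, hHS, hL, hP,
    hC, hjd, hrd⟩

/-! ## §3 S1 of `borel_heegner_squeeze` / `bipartite_toric_borel`, VERBATIM, and with the extras -/

/-- **S1 `stub_heegnerFrame_cmRamified` (`Lines/borel_heegner_squeeze.lean`) ≡ `stub_heegnerFrame_bip`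
(`Lines/bipartite_toric_borel.lean`) — the shared assembly stub of the two Kolyvagin-type lines on the B1 residue of crux
`BottomClassIndexLawFiveLe`, PROVED with its signature VERBATIM** (both stubs close by `exact heegnerFrame_cmRamified`).
For every class member (`W/ℚ` globally minimal with CM, `p ≥ 5` CM-ramified, `r_an(W) = 1`), granted `exists_isNewformOf`
and Hoffstein–Luo 1997: a full anticyclotomic Heegner frame `(N = N_W, K, Dt, H, ι, P, Wd)` with `p ∣ N`, `d_K` odd,
`p ∤ #𝓞_K^×`, Heegner hypothesis for `N`, `L(W^{(d_K)}, 1) ≠ 0`, `ι P = heegnerPointComplex Dt H`, `Wd` a globally minimal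
model of `W^{(d_K)}`, again CM. Proof: `r_an = 1` is odd so `w(W) = −1`
(`rootNumber_eq_neg_one_pow_analyticRank_of_exists_isNewformOf`); §2 gives the frame; `p ∣ N_W` because a CM-ramified
prime is additive (`BorelTorsion.dvd_conductorNorm_of_cmRamified`); `p ≠ 2` divides the Heegner level so `p ∤ #𝓞_K^×`
(`X11b.Three.not_dvd_discr_and_not_dvd_torsionOrder_of_heegner`); `Wd` is CM by the class-number-one `j`-table
(`KatzGenusCrossing.twistModel_facts`). CONDITIONAL on the two named facts (its own antecedents); closes no registered stub.
[cite: HoffsteinLuo1997, Theorem (§1, pp. 435–436)] [cite: BCDTJAMS2001, Thm. A] [cite: GrossZagier1986, I.(6.3)]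
[cite: Darmon2004, Thm. 3.6 and Thm. 3.7] [cite: SilvermanAEC2009, VIII.8 Cor. 8.3, X.5 Prop. 5.4, App. C §16]
[cite: GrossLMS1991, §1 (p. 235)] -/
theorem heegnerFrame_cmRamified :
    exists_isNewformOf → HoffsteinLuo1997_exists_twist_L_one_ne_zero →
    ∀ (W : WeierstrassCurve ℚ) [W.IsElliptic] [W.IsGloballyMinimal] (p : ℕ) [Fact p.Prime],
      W.HasCM → CMRamified W p → 5 ≤ p → W.analyticRank = 1 →
      ∃ (N : ℕ) (_ : NeZero N) (K : Type) (_ : Field K) (_ : NumberField K)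
        (Dt : ModularParametrizationData W N) (H : HeegnerDatum N (NumberField.discr K)) (ι : K →+* ℂ)
        (P : (W.baseChange K).toAffine.Point) (Wd : WeierstrassCurve ℚ) (_ : Wd.IsElliptic)
        (_ : Wd.IsGloballyMinimal),
        W.conductorNorm ℤ = N ∧ p ∣ N ∧ IsImaginaryQuadratic K ∧ Odd (NumberField.discr K) ∧
        ¬ p ∣ Units.torsionOrder K ∧ SatisfiesHeegnerHypothesis N K ∧
        (W.quadraticTwist (NumberField.discr K : ℚ)).entireLFunction 1 ≠ 0 ∧
        WeierstrassCurve.Affine.Point.map ι.toRatAlgHom P = heegnerPointComplex Dt H ∧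
        (∃ C : VariableChange ℚ, C • W.quadraticTwist (NumberField.discr K : ℚ) = Wd) ∧ Wd.HasCM := by
  intro hnf hHL W _ _ p _ hCM hram h5 hr
  have hp : p.Prime := Fact.out
  have hw : W.rootNumber = -1 := by
    rw [WeierstrassCurve.rootNumber_eq_neg_one_pow_analyticRank_of_exists_isNewformOf hnf W, hr]
    norm_num
  obtain ⟨N, iNZ, K, iF, iN, Dt, H, ι, P, Wd, iEd, iMd, hN, hK, -, hd8, -, -, hHN, -, hL, hP, hC, -, -⟩ :=
    exists_heegnerFrame_of_rootNumber_eq_neg_one hnf hHL W hw ∅ 0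
  have hpN : p ∣ N := hN ▸ BorelTorsion.dvd_conductorNorm_of_cmRamified W p hCM hram
  have hμ : ¬ p ∣ Units.torsionOrder K :=
    (Summit.BirchSwinnertonDyer.Rank1Residual.X11b.Three.not_dvd_discr_and_not_dvd_torsionOrder_of_heegner hK hHN
      (p := p) (by omega) hpN).2
  have hodd : Odd (NumberField.discr K) := by
    rw [Int.odd_iff]; omega
  have hd0 : (NumberField.discr K : ℚ) ≠ 0 := by exact_mod_cast NumberField.discr_ne_zero K
  obtain ⟨Cd, hCd⟩ := hC
  have hCd' : Cd⁻¹ • Wd = W.quadraticTwist (NumberField.discr K : ℚ) := by rw [← hCd, inv_smul_smul]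
  obtain ⟨-, hWdCM, -, -⟩ := KatzGenusCrossing.twistModel_facts hd0 hCd' hCM hram
  exact ⟨N, iNZ, K, iF, iN, Dt, H, ι, P, Wd, iEd, iMd, hN, hpN, hK, hodd, hμ, hHN, hL, hP, ⟨Cd, hCd⟩, hWdCM⟩

/-- **S1 with the extras the Kolyvagin lines use next** (same antecedents): for a class member, a bound `B` and a finite set
`S`, the frame of `heegnerFrame_cmRamified` together with `|d_K| > B`, `d_K ≡ 1 (mod 8)`, `#𝓞_K^× = 2`, every prime of `S`
split in `K`, `p ∤ d_K` (the CM-ramified `p` SPLITS in `K`, so `K ≠ ℚ(√−p)`), `j(Wd) = j(W)`, `Wd` CM and CM-ramified at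
`p`, and `r_an(Wd) = 0` (the rank-zero CM partner to which Burungale–Flach applies). CONDITIONAL on the two named facts.
[cite: HoffsteinLuo1997, Theorem (§1, pp. 435–436)] [cite: BCDTJAMS2001, Thm. A] [cite: GrossLMS1991, §1 (p. 235)]
[cite: SilvermanAEC2009, X.5 Prop. 5.4 and App. C §16] -/
theorem heegnerFrame_cmRamified_extras (hnf : exists_isNewformOf)
    (hHL : HoffsteinLuo1997_exists_twist_L_one_ne_zero)
    (W : WeierstrassCurve ℚ) [W.IsElliptic] [W.IsGloballyMinimal] (p : ℕ) [Fact p.Prime]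
    (hCM : W.HasCM) (hram : CMRamified W p) (h5 : 5 ≤ p) (hr : W.analyticRank = 1) (S : Finset ℕ) (B : ℕ) :
    ∃ (N : ℕ) (_ : NeZero N) (K : Type) (_ : Field K) (_ : NumberField K)
      (Dt : ModularParametrizationData W N) (H : HeegnerDatum N (NumberField.discr K)) (ι : K →+* ℂ)
      (P : (W.baseChange K).toAffine.Point) (Wd : WeierstrassCurve ℚ) (_ : Wd.IsElliptic)
      (_ : Wd.IsGloballyMinimal),
      W.conductorNorm ℤ = N ∧ p ∣ N ∧ IsImaginaryQuadratic K ∧ B < (NumberField.discr K).natAbs ∧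
      NumberField.discr K % 8 = 1 ∧ Odd (NumberField.discr K) ∧ ¬ (p : ℤ) ∣ NumberField.discr K ∧
      Units.torsionOrder K = 2 ∧ ¬ p ∣ Units.torsionOrder K ∧
      SatisfiesHeegnerHypothesis N K ∧ (∀ q ∈ S, q.Prime → SatisfiesHeegnerHypothesis q K) ∧
      (W.quadraticTwist (NumberField.discr K : ℚ)).entireLFunction 1 ≠ 0 ∧
      WeierstrassCurve.Affine.Point.map ι.toRatAlgHom P = heegnerPointComplex Dt H ∧
      (∃ C : VariableChange ℚ, C • W.quadraticTwist (NumberField.discr K : ℚ) = Wd) ∧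
      Wd.j = W.j ∧ Wd.HasCM ∧ CMRamified Wd p ∧ Wd.analyticRank = 0 := by
  have hp : p.Prime := Fact.out
  have hw : W.rootNumber = -1 := by
    rw [WeierstrassCurve.rootNumber_eq_neg_one_pow_analyticRank_of_exists_isNewformOf hnf W, hr]
    norm_num
  obtain ⟨N, iNZ, K, iF, iN, Dt, H, ι, P, Wd, iEd, iMd, hN, hK, hB, hd8, -, hμ2, hHN, hHS, hL, hP, hC, hjd, hrd⟩ :=
    exists_heegnerFrame_of_rootNumber_eq_neg_one hnf hHL W hw S B
  have hpN : p ∣ N := hN ▸ BorelTorsion.dvd_conductorNorm_of_cmRamified W p hCM hram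
  obtain ⟨hpd, hμ⟩ :=
    Summit.BirchSwinnertonDyer.Rank1Residual.X11b.Three.not_dvd_discr_and_not_dvd_torsionOrder_of_heegner hK hHN
      (p := p) (by omega) hpN
  have hodd : Odd (NumberField.discr K) := by
    rw [Int.odd_iff]; omega
  have hd0 : (NumberField.discr K : ℚ) ≠ 0 := by exact_mod_cast NumberField.discr_ne_zero K
  obtain ⟨Cd, hCd⟩ := hC
  have hCd' : Cd⁻¹ • Wd = W.quadraticTwist (NumberField.discr K : ℚ) := by rw [← hCd, inv_smul_smul]
  obtain ⟨-, hWdCM, hWdram, -⟩ := KatzGenusCrossing.twistModel_facts hd0 hCd' hCM hram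
  exact ⟨N, iNZ, K, iF, iN, Dt, H, ι, P, Wd, iEd, iMd, hN, hpN, hK, hB, hd8, hodd, hpd, hμ2, hμ, hHN, hHS, hL, hP,
    ⟨Cd, hCd⟩, hjd, hWdCM, hWdram, hrd⟩


/-! ## §4 The Kolyvagin road to the crux with S1 DISCHARGED: `BSD_p` on every member and the crux BY NAME, modulo the eight
prints and the two research halves (UPPER = Kolyvagin's inequality, LOWER = the Heegner-index lower bound) -/

/-- **Every class member has `BSD_p`, modulo GZK, the eight prints and the two research halves UPPER ∧ LOWER of the
Kolyvagin road — with the Heegner frame SUPPLIED (S1 = `heegnerFrame_cmRamified`).** Hypotheses, verbatim from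
`Lines/borel_heegner_squeeze.lean`: the print conjunction S0 (`gross_zagier`, `kolyvagin`, `hasEntireLFunction_rat`,
Gross–Zagier I.(7.3), Cassels, Burungale–Flach, `exists_isNewformOf`, Hoffstein–Luo — named facts, so this is CONDITIONAL),
S2 = `stub_kolyvaginUpper_borelCM` (`Upper.IndexUpperBoundLeAt` at Manin slack `v_p(c(Dt))`, RESEARCH) and S3 =
`stub_indexLower_borelCM` (`IndexLowerBoundLeAt`, RESEARCH); conclusion `BSDp W p` for every member, hence in particular the
registered B1 slots `stub_bsdp_of_level` / `stub_bsdp_of_sha_levelZero` of the line of record (drop their extra binders).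
Route: frame (§3) ↦ `P` non-torsion (Gross–Zagier, `X11b.not_isOfFinAddOrder_of_heegner_of_analyticRank_eq_one`) ↦ UPPER,
LOWER ↦ the CM rank-zero partner `Wd` has `BSD_p` (Burungale–Flach, `bsdp_cm_rankZero`) ↦
`SchneiderFree.Exact.bsdp_of_exactIndexManin_of_partner_bsdp`. Nothing about BSD is proved: UPPER and LOWER are open.
[cite: GrossZagier1986, I.(6.3) and I.(7.3)] [cite: BurungaleFlach2024, Thm. 1.1 and Cor. 2] [cite: Cassels1965ArithmeticVIII, Thm. 1.3] -/
theorem bsdp_of_prints_of_kolyvaginUpper_of_indexLower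
    (hS0 : (∀ (N : ℕ) [NeZero N] (W : WeierstrassCurve ℚ) (K : Type) [Field K] [NumberField K], gross_zagier N W K) ∧
      (∀ (N : ℕ) [NeZero N] (W : WeierstrassCurve ℚ) (K : Type) [Field K] [NumberField K], kolyvagin N W K) ∧
      hasEntireLFunction_rat ∧ GrossZagier1986_thm_I_7_3 ∧ bsdRHS_eq_of_isIsogenous ∧
      bsdTriple_of_hasCM_of_L_one_ne_zero ∧ exists_isNewformOf ∧ HoffsteinLuo1997_exists_twist_L_one_ne_zero)
    (hUpper : ∀ (W : WeierstrassCurve ℚ) [W.IsElliptic] [W.IsGloballyMinimal] (p : ℕ) [Fact p.Prime],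
      W.HasCM → CMRamified W p → 5 ≤ p → W.analyticRank = 1 →
      ∀ (N : ℕ) [NeZero N] (K : Type) [Field K] [NumberField K]
        (Dt : ModularParametrizationData W N) (H : HeegnerDatum N (NumberField.discr K)) (ι : K →+* ℂ)
        (P : (W.baseChange K).toAffine.Point),
        W.conductorNorm ℤ = N → IsImaginaryQuadratic K → Odd (NumberField.discr K) →
        ¬ p ∣ Units.torsionOrder K → SatisfiesHeegnerHypothesis N K →
        (W.quadraticTwist (NumberField.discr K : ℚ)).entireLFunction 1 ≠ 0 →
        WeierstrassCurve.Affine.Point.map ι.toRatAlgHom P = heegnerPointComplex Dt H →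
        ¬ IsOfFinAddOrder P →
        Upper.IndexUpperBoundLeAt W p K P (padicValNat p Dt.c.natAbs))
    (hLower : ∀ (W : WeierstrassCurve ℚ) [W.IsElliptic] [W.IsGloballyMinimal] (p : ℕ) [Fact p.Prime],
      W.HasCM → CMRamified W p → 5 ≤ p → W.analyticRank = 1 →
      ∀ (N : ℕ) [NeZero N] (K : Type) [Field K] [NumberField K]
        (Dt : ModularParametrizationData W N) (H : HeegnerDatum N (NumberField.discr K)) (ι : K →+* ℂ)
        (P : (W.baseChange K).toAffine.Point),
        W.conductorNorm ℤ = N → IsImaginaryQuadratic K → Odd (NumberField.discr K) →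
        ¬ p ∣ Units.torsionOrder K → SatisfiesHeegnerHypothesis N K →
        (W.quadraticTwist (NumberField.discr K : ℚ)).entireLFunction 1 ≠ 0 →
        WeierstrassCurve.Affine.Point.map ι.toRatAlgHom P = heegnerPointComplex Dt H →
        ¬ IsOfFinAddOrder P →
        IndexLowerBoundLeAt W p K P (padicValNat p Dt.c.natAbs)) :
    rank_eq_analyticRank_of_analyticRank_le_one →
    ∀ (W : WeierstrassCurve ℚ) [W.IsElliptic] [W.IsGloballyMinimal] (p : ℕ) [Fact p.Prime],
      W.HasCM → CMRamified W p → 5 ≤ p → W.analyticRank = 1 → BSDp W p := by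
  obtain ⟨hGZ, hKo, hmod, hGZ73, -, hBF, hnf, hHL⟩ := hS0
  intro hGZK W _ _ p _ hCM hram h5 hr
  have hp2 : p ≠ 2 := by
    rintro rfl
    omega
  obtain ⟨N, iNZ, K, iF, iN, Dt, H, ι, P, Wd, iEd, iMd, hN, hpN, hK, hodd, hw, hHH, hLd, hP, hC, hWdCM⟩ :=
    heegnerFrame_cmRamified hnf hHL W p hCM hram h5 hr
  have hPinf : ¬ IsOfFinAddOrder P :=
    X11b.not_isOfFinAddOrder_of_heegner_of_analyticRank_eq_one W N K Dt H ι P (hGZ N W K) hmod hr hK hHH hLd hP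
  have hup : Upper.IndexUpperBoundLeAt W p K P (padicValNat p Dt.c.natAbs) :=
    hUpper W p hCM hram h5 hr N K Dt H ι P hN hK hodd hw hHH hLd hP hPinf
  have hlo : IndexLowerBoundLeAt W p K P (padicValNat p Dt.c.natAbs) :=
    hLower W p hCM hram h5 hr N K Dt H ι P hN hK hodd hw hHH hLd hP hPinf
  -- the rank-zero CM partner: `L(Wd, 1) ≠ 0`, hence `r_an(Wd) = 0`, hence `BSD_p(Wd)` (Burungale–Flach)
  obtain ⟨Cd, hCd⟩ := hC
  have hD0 : (NumberField.discr K : ℚ) ≠ 0 := by exact_mod_cast NumberField.discr_ne_zero K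
  haveI : (W.quadraticTwist (NumberField.discr K : ℚ)).IsElliptic := W.isElliptic_quadraticTwist hD0
  have hLd1 : Wd.entireLFunction 1 ≠ 0 := by rw [← hCd, entireLFunction_smul]; exact hLd
  have hrd : Wd.analyticRank = 0 := Rank1Residual.analyticRank_eq_zero_of_entireLFunction_one_ne_zero hLd1
  have hWd : BSDp Wd p := bsdp_cm_rankZero hBF hmod hWdCM hrd
  exact Exact.bsdp_of_exactIndexManin_of_partner_bsdp hGZ hKo hGZK hmod hGZ73 W p N K Dt H ι P Wd hr hN hpN hK hodd
    hw hHH hLd hP ⟨Cd, hCd⟩ hp2 hlo hup hWd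

/-- **END STATE OF THE KOLYVAGIN ROAD WITH THE FRAME SUPPLIED, BY NAME**: the crux
`Theses.PrintCFram.BottomClassIndexLawFiveLe` follows from the eight prints (S0, named facts — CONDITIONAL), Kolyvagin's
inequality at the Borel CM-ramified prime (UPPER, research) and the Heegner-index lower bound (LOWER, research); the frame stub S1
of `borel_heegner_squeeze` / `bipartite_toric_borel` is no longer an input (§3). GZK is the crux's own antecedent and is used, not
assumed; `BSDp W p` (previous theorem) ↦ the K7r dictionary `RubinFormulaZpBsdp.ramifiedCMBottomClassIndexLawAtZp_of_bsdp`
(Cassels VIII.1.3 across the CM isogeny class ↦ Rubin's exact index law at `ℤ_p`). Nothing about BSD is proved; this closes no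
registered stub of the line of record. [cite: Cassels1965ArithmeticVIII, Thm. 1.3] [cite: Miller2011LMS, Def. 1.1 (arXiv:1010.2431 p. 3)] -/
theorem bottomClassIndexLawFiveLe_of_prints_of_kolyvaginUpper_of_indexLower
    (hS0 : (∀ (N : ℕ) [NeZero N] (W : WeierstrassCurve ℚ) (K : Type) [Field K] [NumberField K], gross_zagier N W K) ∧
      (∀ (N : ℕ) [NeZero N] (W : WeierstrassCurve ℚ) (K : Type) [Field K] [NumberField K], kolyvagin N W K) ∧
      hasEntireLFunction_rat ∧ GrossZagier1986_thm_I_7_3 ∧ bsdRHS_eq_of_isIsogenous ∧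
      bsdTriple_of_hasCM_of_L_one_ne_zero ∧ exists_isNewformOf ∧ HoffsteinLuo1997_exists_twist_L_one_ne_zero)
    (hUpper : ∀ (W : WeierstrassCurve ℚ) [W.IsElliptic] [W.IsGloballyMinimal] (p : ℕ) [Fact p.Prime],
      W.HasCM → CMRamified W p → 5 ≤ p → W.analyticRank = 1 →
      ∀ (N : ℕ) [NeZero N] (K : Type) [Field K] [NumberField K]
        (Dt : ModularParametrizationData W N) (H : HeegnerDatum N (NumberField.discr K)) (ι : K →+* ℂ)
        (P : (W.baseChange K).toAffine.Point),
        W.conductorNorm ℤ = N → IsImaginaryQuadratic K → Odd (NumberField.discr K) →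
        ¬ p ∣ Units.torsionOrder K → SatisfiesHeegnerHypothesis N K →
        (W.quadraticTwist (NumberField.discr K : ℚ)).entireLFunction 1 ≠ 0 →
        WeierstrassCurve.Affine.Point.map ι.toRatAlgHom P = heegnerPointComplex Dt H →
        ¬ IsOfFinAddOrder P →
        Upper.IndexUpperBoundLeAt W p K P (padicValNat p Dt.c.natAbs))
    (hLower : ∀ (W : WeierstrassCurve ℚ) [W.IsElliptic] [W.IsGloballyMinimal] (p : ℕ) [Fact p.Prime],
      W.HasCM → CMRamified W p → 5 ≤ p → W.analyticRank = 1 →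
      ∀ (N : ℕ) [NeZero N] (K : Type) [Field K] [NumberField K]
        (Dt : ModularParametrizationData W N) (H : HeegnerDatum N (NumberField.discr K)) (ι : K →+* ℂ)
        (P : (W.baseChange K).toAffine.Point),
        W.conductorNorm ℤ = N → IsImaginaryQuadratic K → Odd (NumberField.discr K) →
        ¬ p ∣ Units.torsionOrder K → SatisfiesHeegnerHypothesis N K →
        (W.quadraticTwist (NumberField.discr K : ℚ)).entireLFunction 1 ≠ 0 →
        WeierstrassCurve.Affine.Point.map ι.toRatAlgHom P = heegnerPointComplex Dt H →
        ¬ IsOfFinAddOrder P →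
        IndexLowerBoundLeAt W p K P (padicValNat p Dt.c.natAbs)) :
    Summit.BirchSwinnertonDyer.BirchSwinnertonDyer.Theses.PrintCFram.BottomClassIndexLawFiveLe := by
  have hmod : hasEntireLFunction_rat := hS0.2.2.1
  have hCassels : bsdRHS_eq_of_isIsogenous := hS0.2.2.2.2.1
  intro hGZK W _ _ p _ hCM hram h5 hr
  exact RubinFormulaZpBsdp.ramifiedCMBottomClassIndexLawAtZp_of_bsdp hCassels hmod hGZK hr.le
    (bsdp_of_prints_of_kolyvaginUpper_of_indexLower hS0 hUpper hLower hGZK W p hCM hram h5 hr)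

end Summit.BirchSwinnertonDyer.BirchSwinnertonDyer.Theorems.PrintCFram.HeegnerFrameSupply

end
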